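import Summits.HubbardSuperconductivity.HubbardSuperconductivity.Theorems.BirComplexStableXY.Negative.WitnessTable

/-!
# Negative lemma for `BalabanIR.BirComplexStableXY` (stmt-HubbardSuperconductivity-2080) modulo `WitnessZeroExists`

The crux (route BalabanIR's "engine": for every `r ≥ 2, B, c₀ > 0` there are `K₀, L₀` such that for ALL
admissible complex window tables and ALL `L₀ ≤ L ≤ M`, `Z ≠ 0` and the slice order is `≥ 1/2`) is false as
typed: an ADMISSIBLE table whose temporal stiffness is complex (`1 + iε₁`) plus a Berry-like term
`iε₂ sin ∂_τθ` has transfer-operator (Beraha–Kahane–Weiss) zeros of `Z = Tr T^M` in the regime `M ~ K²L⁴`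
(the route needs `M → ∞` at fixed `L`): the tops of two charge sectors tie in modulus (the `ε₂` term only
reweights sectors by `e^{iQψ}`, a gauge identity) and carry a tunable relative phase `≈ ε₁/(4κ_eff²)` per
step, so the two dominant terms cancel at `M ≈ 4πκ_eff²/ε₁` (numerics on the item's evidence: route-review
Crux2_TransferZeros.md — zero-mode chain κ = 30/100/300 → M = 5515/64029/583437, |Z_M|/top^M ≤ 1e-11 — and
the standing disprover's jobs j004976, j005270, j006015, j006016, j006369).
THIS FILE lands the kernel-checked part: `witness_admissible` — the witness satisfies the crux's four
hypotheses ((U1), (N), (A) with `B = 128`, (C) with `c₀ = 1/18`; (C) by bit-fixing routing on the cube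
`{0,1}³`: every ordered pair of window sites is joined by a coordinate-fixing path, each undirected edge
carries weighted load ≤ 18) — and the NEGATIVE LEMMA
`BirComplexStableXY_false_of_WitnessZeroExists : WitnessZeroExists → ¬ BirComplexStableXY`, with
`WitnessZeroExists` (zeros of the crux's own `Z` for this family at arbitrarily large `K`) as hypothesis H of
the negative-lemma protocol — no verdict.  REPAIR for the planner (it excludes the witness; checked in the crux
work file together with `Z ∈ ℝ` under it): insert Osterwalder–Schrader Hermiticity of the table,
`(∀ n, c (fun w => n (w.1, w.2.1, Fin.rev w.2.2)) = (starRingEnd ℂ) (c (-n))) →`, after hypothesis (C).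
Standing disprover refuter-cdisprove-stmt-HubbardSuperconductivity-2080-0, 2026-08-16.
-/

namespace Summit.HubbardSuperconductivity.BirComplexStableXYNegative

open scoped BigOperators
open MeasureTheory Literature.Probability.LatticeModels
open Summit.HubbardSuperconductivity.HubbardSuperconductivity.Theses.BalabanIR

noncomputable section

/-! ### §3c Properties of the witness table -/

/-- (U1) for the witness. -/
theorem condU1_witness (ε₁ ε₂ : ℝ) : (∀ m ∈ (witness ε₁ ε₂).support, ∑ w, m w = 0) :=
  condU1_add (condU1_add (condU1_map_cosTab _) (condU1_smul _ (condU1_map_cosTab _)))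
    (condU1_smul _ (condU1_map_sinTab _))

/-- (N) for the witness. -/
theorem condN_witness (ε₁ ε₂ : ℝ) : (witness ε₁ ε₂).sum (fun _ a => a) = 0 := by
  change tsum (witness ε₁ ε₂) = 0
  simp only [witness, spatialTab, temporalCosTab, temporalSinTab, spatialEdges, temporalEdges,
    tsum_add, tsum_smul, List.map_cons, List.map_nil, List.sum_cons, List.sum_nil,
    tsum_cosTab, tsum_sinTab, tsum_zero]
  ring

/-- weighted norm of the spatial part `≤ 8(1+e²)`. -/
theorem normA_spatialTab : normA spatialTab ≤ 8 * (1 + Real.exp 2) := by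
  refine (normA_list_sum_le _).trans ?_
  simp only [spatialEdges, List.map_cons, List.map_nil, List.sum_cons, List.sum_nil]
  have h1 := normA_cosTab (u := vx 1 0 0) (v := vx 0 0 0) (by decide)
  have h2 := normA_cosTab (u := vx 1 0 1) (v := vx 0 0 1) (by decide)
  have h3 := normA_cosTab (u := vx 1 1 0) (v := vx 0 1 0) (by decide)
  have h4 := normA_cosTab (u := vx 1 1 1) (v := vx 0 1 1) (by decide)
  have h5 := normA_cosTab (u := vx 0 1 0) (v := vx 0 0 0) (by decide)
  have h6 := normA_cosTab (u := vx 0 1 1) (v := vx 0 0 1) (by decide)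
  have h7 := normA_cosTab (u := vx 1 1 0) (v := vx 1 0 0) (by decide)
  have h8 := normA_cosTab (u := vx 1 1 1) (v := vx 1 0 1) (by decide)
  simp only [vx] at h1 h2 h3 h4 h5 h6 h7 h8 ⊢
  linarith

/-- weighted norm of the temporal cosine part `≤ 4(1+e²)`. -/
theorem normA_temporalCosTab : normA temporalCosTab ≤ 4 * (1 + Real.exp 2) := by
  refine (normA_list_sum_le _).trans ?_
  simp only [temporalEdges, List.map_cons, List.map_nil, List.sum_cons, List.sum_nil]
  have h1 := normA_cosTab (u := vx 0 0 1) (v := vx 0 0 0) (by decide)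
  have h2 := normA_cosTab (u := vx 0 1 1) (v := vx 0 1 0) (by decide)
  have h3 := normA_cosTab (u := vx 1 0 1) (v := vx 1 0 0) (by decide)
  have h4 := normA_cosTab (u := vx 1 1 1) (v := vx 1 1 0) (by decide)
  simp only [vx] at h1 h2 h3 h4 ⊢
  linarith

/-- weighted norm of the temporal sine part `≤ 4e²`. -/
theorem normA_temporalSinTab : normA temporalSinTab ≤ 4 * Real.exp 2 := by
  refine (normA_list_sum_le _).trans ?_
  simp only [temporalEdges, List.map_cons, List.map_nil, List.sum_cons, List.sum_nil]
  have h1 := normA_sinTab (u := vx 0 0 1) (v := vx 0 0 0) (by decide)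
  have h2 := normA_sinTab (u := vx 0 1 1) (v := vx 0 1 0) (by decide)
  have h3 := normA_sinTab (u := vx 1 0 1) (v := vx 1 0 0) (by decide)
  have h4 := normA_sinTab (u := vx 1 1 1) (v := vx 1 1 0) (by decide)
  simp only [vx] at h1 h2 h3 h4 ⊢
  linarith

/-- `e² < 7.3891`. -/
theorem exp_two_lt : Real.exp 2 < 7.3891 := by
  have h := Real.exp_one_lt_d9
  have h2 : Real.exp 2 = Real.exp 1 * Real.exp 1 := by rw [← Real.exp_add]; norm_num
  rw [h2]
  nlinarith [Real.exp_pos 1]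

/-- `‖1 + iε‖ ≤ 3/2` for `|ε| ≤ 1`. -/
theorem norm_one_add_I_mul_le {ε : ℝ} (h : |ε| ≤ 1) : ‖(1 : ℂ) + Complex.I * ε‖ ≤ 3/2 := by
  have hsq : ‖(1 : ℂ) + Complex.I * ε‖ ^ 2 = 1 + ε ^ 2 := by
    rw [Complex.sq_norm]; simp [Complex.normSq_apply]; ring
  have hε : ε ^ 2 ≤ 1 := by
    have := abs_nonneg ε
    calc ε ^ 2 = |ε| ^ 2 := (sq_abs ε).symm
      _ ≤ 1 := by nlinarith
  nlinarith [norm_nonneg ((1 : ℂ) + Complex.I * ε)]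

/-- (A) for the witness: `normA ≤ 8(1+e²) + (3/2)·4(1+e²) + (1/5)·4e² < 128`. -/
theorem condA_witness {ε₁ ε₂ : ℝ} (h₁ : |ε₁| ≤ 1) (h₂ : |ε₂| ≤ 1/5) : normA (witness ε₁ ε₂) ≤ 128 := by
  have hS := normA_spatialTab
  have hC := normA_temporalCosTab
  have hT := normA_temporalSinTab
  have hn₁ := norm_one_add_I_mul_le h₁
  have hn₂ : ‖Complex.I * (ε₂ : ℂ)‖ ≤ 1/5 := by simpa using h₂
  have he := exp_two_lt
  have hC0 := normA_nonneg temporalCosTab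
  have hT0 := normA_nonneg temporalSinTab
  have step1 := normA_add_le (spatialTab + ((1 : ℂ) + Complex.I * ε₁) • temporalCosTab)
    ((Complex.I * ε₂) • temporalSinTab)
  have step2 := normA_add_le spatialTab (((1 : ℂ) + Complex.I * ε₁) • temporalCosTab)
  rw [normA_smul] at step1 step2
  have b1 : ‖(1 : ℂ) + Complex.I * ε₁‖ * normA temporalCosTab ≤ (3/2) * (4 * (1 + Real.exp 2)) :=
    mul_le_mul hn₁ hC hC0 (by norm_num)
  have b2 : ‖Complex.I * (ε₂ : ℂ)‖ * normA temporalSinTab ≤ (1/5) * (4 * Real.exp 2) :=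
    mul_le_mul hn₂ hT hT0 (by norm_num)
  unfold witness
  linarith

/-- `cos(a − b) = cos(b − a)`. -/
theorem cos_sub_comm' (a b : ℝ) : Real.cos (a - b) = Real.cos (b - a) := by
  rw [← Real.cos_neg, neg_sub]

/-- the elementary path inequality `1 − cos(x−z) ≤ 2(1−cos(x−y)) + 2(1−cos(y−z))`
(i.e. `|1 − e^{i(a+b)}|² ≤ 2|1−e^{ia}|² + 2|1−e^{ib}|²`). -/
theorem cos_path2 (x y z : ℝ) :
    1 - Real.cos (x - z) ≤ 2 * (1 - Real.cos (x - y)) + 2 * (1 - Real.cos (y - z)) := by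
  have hx : x - z = 2 * ((x - y) / 2 + (y - z) / 2) := by ring
  set a := (x - y) / 2 with ha
  set b := (y - z) / 2 with hb
  have h1 : 1 - Real.cos (x - z) = 2 * Real.sin (a + b) ^ 2 := by
    rw [hx, Real.cos_two_mul, Real.cos_sq']; ring
  have h2 : 1 - Real.cos (x - y) = 2 * Real.sin a ^ 2 := by
    rw [show x - y = 2 * a by rw [ha]; ring, Real.cos_two_mul, Real.cos_sq']; ring
  have h3 : 1 - Real.cos (y - z) = 2 * Real.sin b ^ 2 := by
    rw [show y - z = 2 * b by rw [hb]; ring, Real.cos_two_mul, Real.cos_sq']; ring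
  rw [h1, h2, h3, Real.sin_add]
  have ca := Real.cos_sq_le_one a
  have cb := Real.cos_sq_le_one b
  nlinarith [mul_self_nonneg (Real.sin a * Real.cos b - Real.cos a * Real.sin b),
    mul_nonneg (sq_nonneg (Real.sin a)) (sub_nonneg.2 cb),
    mul_nonneg (sq_nonneg (Real.sin b)) (sub_nonneg.2 ca)]

/-- length-three chaining with the constants `(2,4,4)` (enough for `c₀ = 1/18`). -/
theorem cos_path3 (x y z t : ℝ) :
    1 - Real.cos (x - t) ≤ 2 * (1 - Real.cos (x - y)) + 4 * (1 - Real.cos (y - z)) +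
      4 * (1 - Real.cos (z - t)) := by
  have h1 := cos_path2 x y t
  have h2 := cos_path2 y z t
  linarith

/-- real part of the witness generating function: the twelve cube edges, unit weight each. -/
def S12 (φ : W 2 → ℝ) : ℝ :=
  (1 - Real.cos (φ (1, 0, 0) - φ (0, 0, 0))) + (1 - Real.cos (φ (1, 0, 1) - φ (0, 0, 1))) +
  (1 - Real.cos (φ (1, 1, 0) - φ (0, 1, 0))) + (1 - Real.cos (φ (1, 1, 1) - φ (0, 1, 1))) +
  (1 - Real.cos (φ (0, 1, 0) - φ (0, 0, 0))) + (1 - Real.cos (φ (0, 1, 1) - φ (0, 0, 1))) +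
  (1 - Real.cos (φ (1, 1, 0) - φ (1, 0, 0))) + (1 - Real.cos (φ (1, 1, 1) - φ (1, 0, 1))) +
  (1 - Real.cos (φ (0, 0, 1) - φ (0, 0, 0))) + (1 - Real.cos (φ (0, 1, 1) - φ (0, 1, 0))) +
  (1 - Real.cos (φ (1, 0, 1) - φ (1, 0, 0))) + (1 - Real.cos (φ (1, 1, 1) - φ (1, 1, 0)))

/-- real part of the witness generating function = the twelve cube edges. -/
theorem genF_witness_re (ε₁ ε₂ : ℝ) (φ : W 2 → ℝ) : (genF (witness ε₁ ε₂) φ).re = S12 φ := by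
  simp only [witness, spatialTab, temporalCosTab, temporalSinTab, spatialEdges, temporalEdges,
    List.map_cons, List.map_nil, List.sum_cons, List.sum_nil, genF_add, genF_smul,
    genF_cosTab, genF_sinTab, vx, S12, add_zero, Complex.add_re, Complex.add_im,
    Complex.mul_re, Complex.mul_im, Complex.ofReal_re, Complex.ofReal_im, Complex.I_re, Complex.I_im,
    Complex.one_re, Complex.one_im]
  ring

/-- (C) COERCIVITY of the witness with `c₀ = 1/18` (bit-fixing routing on the cube; every undirected
edge carries weighted load ≤ 18). -/
theorem condC_witness (ε₁ ε₂ : ℝ) (φ : W 2 → ℝ) :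
    (1/18 : ℝ) * ∑ w, ∑ w', (1 - Real.cos (φ w - φ w')) ≤ (genF (witness ε₁ ε₂) φ).re := by
  rw [genF_witness_re]
  simp only [S12, Fintype.sum_prod_type, Fin.sum_univ_two, sub_self, Real.cos_zero]
  have s1 : Real.cos (φ (0, 0, 0) - φ (1, 0, 0)) = Real.cos (φ (1, 0, 0) - φ (0, 0, 0)) := cos_sub_comm' _ _
  have n1 : 0 ≤ 1 - Real.cos (φ (1, 0, 0) - φ (0, 0, 0)) := sub_nonneg.2 (Real.cos_le_one _)
  have s2 : Real.cos (φ (0, 0, 0) - φ (0, 1, 0)) = Real.cos (φ (0, 1, 0) - φ (0, 0, 0)) := cos_sub_comm' _ _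
  have n2 : 0 ≤ 1 - Real.cos (φ (0, 1, 0) - φ (0, 0, 0)) := sub_nonneg.2 (Real.cos_le_one _)
  have s3 : Real.cos (φ (0, 0, 0) - φ (0, 0, 1)) = Real.cos (φ (0, 0, 1) - φ (0, 0, 0)) := cos_sub_comm' _ _
  have n3 : 0 ≤ 1 - Real.cos (φ (0, 0, 1) - φ (0, 0, 0)) := sub_nonneg.2 (Real.cos_le_one _)
  have s4 : Real.cos (φ (0, 0, 1) - φ (1, 0, 1)) = Real.cos (φ (1, 0, 1) - φ (0, 0, 1)) := cos_sub_comm' _ _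
  have n4 : 0 ≤ 1 - Real.cos (φ (1, 0, 1) - φ (0, 0, 1)) := sub_nonneg.2 (Real.cos_le_one _)
  have s5 : Real.cos (φ (0, 0, 1) - φ (0, 1, 1)) = Real.cos (φ (0, 1, 1) - φ (0, 0, 1)) := cos_sub_comm' _ _
  have n5 : 0 ≤ 1 - Real.cos (φ (0, 1, 1) - φ (0, 0, 1)) := sub_nonneg.2 (Real.cos_le_one _)
  have s6 : Real.cos (φ (0, 1, 0) - φ (1, 1, 0)) = Real.cos (φ (1, 1, 0) - φ (0, 1, 0)) := cos_sub_comm' _ _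
  have n6 : 0 ≤ 1 - Real.cos (φ (1, 1, 0) - φ (0, 1, 0)) := sub_nonneg.2 (Real.cos_le_one _)
  have s7 : Real.cos (φ (0, 1, 0) - φ (0, 1, 1)) = Real.cos (φ (0, 1, 1) - φ (0, 1, 0)) := cos_sub_comm' _ _
  have n7 : 0 ≤ 1 - Real.cos (φ (0, 1, 1) - φ (0, 1, 0)) := sub_nonneg.2 (Real.cos_le_one _)
  have s8 : Real.cos (φ (0, 1, 1) - φ (1, 1, 1)) = Real.cos (φ (1, 1, 1) - φ (0, 1, 1)) := cos_sub_comm' _ _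
  have n8 : 0 ≤ 1 - Real.cos (φ (1, 1, 1) - φ (0, 1, 1)) := sub_nonneg.2 (Real.cos_le_one _)
  have s9 : Real.cos (φ (1, 0, 0) - φ (1, 1, 0)) = Real.cos (φ (1, 1, 0) - φ (1, 0, 0)) := cos_sub_comm' _ _
  have n9 : 0 ≤ 1 - Real.cos (φ (1, 1, 0) - φ (1, 0, 0)) := sub_nonneg.2 (Real.cos_le_one _)
  have s10 : Real.cos (φ (1, 0, 0) - φ (1, 0, 1)) = Real.cos (φ (1, 0, 1) - φ (1, 0, 0)) := cos_sub_comm' _ _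
  have n10 : 0 ≤ 1 - Real.cos (φ (1, 0, 1) - φ (1, 0, 0)) := sub_nonneg.2 (Real.cos_le_one _)
  have s11 : Real.cos (φ (1, 0, 1) - φ (1, 1, 1)) = Real.cos (φ (1, 1, 1) - φ (1, 0, 1)) := cos_sub_comm' _ _
  have n11 : 0 ≤ 1 - Real.cos (φ (1, 1, 1) - φ (1, 0, 1)) := sub_nonneg.2 (Real.cos_le_one _)
  have s12 : Real.cos (φ (1, 1, 0) - φ (1, 1, 1)) = Real.cos (φ (1, 1, 1) - φ (1, 1, 0)) := cos_sub_comm' _ _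
  have n12 : 0 ≤ 1 - Real.cos (φ (1, 1, 1) - φ (1, 1, 0)) := sub_nonneg.2 (Real.cos_le_one _)
  have p1 := cos_path2 (φ (0, 0, 0)) (φ (0, 1, 0)) (φ (0, 1, 1))
  have p2 := cos_path2 (φ (0, 0, 0)) (φ (1, 0, 0)) (φ (1, 0, 1))
  have p3 := cos_path2 (φ (0, 0, 0)) (φ (1, 0, 0)) (φ (1, 1, 0))
  have q1 := cos_path3 (φ (0, 0, 0)) (φ (1, 0, 0)) (φ (1, 1, 0)) (φ (1, 1, 1))
  have p4 := cos_path2 (φ (0, 0, 1)) (φ (0, 1, 1)) (φ (0, 1, 0))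
  have p5 := cos_path2 (φ (0, 0, 1)) (φ (1, 0, 1)) (φ (1, 0, 0))
  have q2 := cos_path3 (φ (0, 0, 1)) (φ (1, 0, 1)) (φ (1, 1, 1)) (φ (1, 1, 0))
  have p6 := cos_path2 (φ (0, 0, 1)) (φ (1, 0, 1)) (φ (1, 1, 1))
  have p7 := cos_path2 (φ (0, 1, 0)) (φ (0, 0, 0)) (φ (0, 0, 1))
  have p8 := cos_path2 (φ (0, 1, 0)) (φ (1, 1, 0)) (φ (1, 0, 0))
  have q3 := cos_path3 (φ (0, 1, 0)) (φ (1, 1, 0)) (φ (1, 0, 0)) (φ (1, 0, 1))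
  have p9 := cos_path2 (φ (0, 1, 0)) (φ (1, 1, 0)) (φ (1, 1, 1))
  have p10 := cos_path2 (φ (0, 1, 1)) (φ (0, 0, 1)) (φ (0, 0, 0))
  have q4 := cos_path3 (φ (0, 1, 1)) (φ (1, 1, 1)) (φ (1, 0, 1)) (φ (1, 0, 0))
  have p11 := cos_path2 (φ (0, 1, 1)) (φ (1, 1, 1)) (φ (1, 0, 1))
  have p12 := cos_path2 (φ (0, 1, 1)) (φ (1, 1, 1)) (φ (1, 1, 0))
  have p13 := cos_path2 (φ (1, 0, 0)) (φ (0, 0, 0)) (φ (0, 0, 1))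
  have p14 := cos_path2 (φ (1, 0, 0)) (φ (0, 0, 0)) (φ (0, 1, 0))
  have q5 := cos_path3 (φ (1, 0, 0)) (φ (0, 0, 0)) (φ (0, 1, 0)) (φ (0, 1, 1))
  have p15 := cos_path2 (φ (1, 0, 0)) (φ (1, 1, 0)) (φ (1, 1, 1))
  have p16 := cos_path2 (φ (1, 0, 1)) (φ (0, 0, 1)) (φ (0, 0, 0))
  have q6 := cos_path3 (φ (1, 0, 1)) (φ (0, 0, 1)) (φ (0, 1, 1)) (φ (0, 1, 0))
  have p17 := cos_path2 (φ (1, 0, 1)) (φ (0, 0, 1)) (φ (0, 1, 1))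
  have p18 := cos_path2 (φ (1, 0, 1)) (φ (1, 1, 1)) (φ (1, 1, 0))
  have p19 := cos_path2 (φ (1, 1, 0)) (φ (0, 1, 0)) (φ (0, 0, 0))
  have q7 := cos_path3 (φ (1, 1, 0)) (φ (0, 1, 0)) (φ (0, 0, 0)) (φ (0, 0, 1))
  have p20 := cos_path2 (φ (1, 1, 0)) (φ (0, 1, 0)) (φ (0, 1, 1))
  have p21 := cos_path2 (φ (1, 1, 0)) (φ (1, 0, 0)) (φ (1, 0, 1))
  have q8 := cos_path3 (φ (1, 1, 1)) (φ (0, 1, 1)) (φ (0, 0, 1)) (φ (0, 0, 0))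
  have p22 := cos_path2 (φ (1, 1, 1)) (φ (0, 1, 1)) (φ (0, 0, 1))
  have p23 := cos_path2 (φ (1, 1, 1)) (φ (0, 1, 1)) (φ (0, 1, 0))
  have p24 := cos_path2 (φ (1, 1, 1)) (φ (1, 0, 1)) (φ (1, 0, 0))
  linarith

/-- THE WITNESS IS ADMISSIBLE: the crux's four hypotheses (U1), (N), (A) with `B = 128`, (C) with
`c₀ = 1/18`, for all `|ε₁| ≤ 1`, `|ε₂| ≤ 1/5`. -/
theorem witness_admissible {ε₁ ε₂ : ℝ} (h₁ : |ε₁| ≤ 1) (h₂ : |ε₂| ≤ 1/5) :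
    (∀ m ∈ (witness ε₁ ε₂).support, ∑ w, m w = 0) ∧
    (witness ε₁ ε₂).sum (fun _ a => a) = 0 ∧
    (witness ε₁ ε₂).sum (fun n a => ‖a‖ * Real.exp (∑ w, |(n w : ℝ)|)) ≤ 128 ∧
    (∀ φ : W 2 → ℝ, (1/18 : ℝ) * ∑ w, ∑ w', (1 - Real.cos (φ w - φ w')) ≤ (genF (witness ε₁ ε₂) φ).re) :=
  ⟨condU1_witness ε₁ ε₂, condN_witness ε₁ ε₂, condA_witness h₁ h₂, condC_witness ε₁ ε₂⟩

/-- HYPOTHESIS H of the negative lemma — the analytic heart, not constructible in the tree today: for the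
witness family the crux's own partition function `Z` vanishes at arbitrarily large `K`, beyond every size
threshold `L₀`, with `|ε₁| ≤ 1`, `|ε₂| ≤ 1/5`.  Proof programme at fixed `L`: trace-class transfer operator
and charge sectors; the gauge identity reducing `ε₂` to sector weights `e^{iQψ}`; ordering of sector tops for
real stiffness (rotor gap); non-degeneracy `d/dκ[κ log(μ₀/μ₁)] ≠ 0`; a tail bound `Σ_rest |λ_j|^M ≤ C q^M`;
degree theory in the `(ε₁, ε₂)` plane (Beraha–Kahane–Weiss accumulation of zeros of `Σ_j λ_j^M`).
[topic: Probability/LatticeModels] -/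
def WitnessZeroExists : Prop :=
  ∀ (K₀ : ℝ) (L₀ : ℕ), ∃ K : ℝ, K₀ ≤ K ∧ ∃ ε₁ ε₂ : ℝ, |ε₁| ≤ 1 ∧ |ε₂| ≤ 1/5 ∧
    ∃ (L M : ℕ) (_ : NeZero L) (_ : NeZero M), L₀ ≤ L ∧ L ≤ M ∧ partZ K (witness ε₁ ε₂) L M = 0

/-- NEGATIVE LEMMA MODULO H: zeros of `Z` for the (admissible — `witness_admissible`) witness family refute
the crux `BalabanIR.BirComplexStableXY` (stmt-HubbardSuperconductivity-2080).  Pure logic: instantiate the crux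
at `r = 2`, `B = 128`, `c₀ = 1/18`, feed the witness, contradict `Z ≠ 0`. -/
theorem BirComplexStableXY_false_of_WitnessZeroExists :
    WitnessZeroExists →
      ¬ Summit.HubbardSuperconductivity.HubbardSuperconductivity.Theses.BalabanIR.BirComplexStableXY := by
  intro hzero h
  obtain ⟨K₀, L₀, hK⟩ := h 2 128 (1/18) le_rfl (by norm_num)
  obtain ⟨K, hKK, ε₁, ε₂, h1, h2, L, M, _, _, hL, hLM, hZ⟩ := hzero K₀ L₀
  obtain ⟨hU1, hN, hA, hC⟩ := witness_admissible h1 h2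
  have key := hK K hKK (witness ε₁ ε₂) hU1 hN hA hC L M hL hLM
  dsimp only at key
  dsimp only [partZ, action, genF, sh, cube] at hZ
  exact key.1 hZ

end

end Summit.HubbardSuperconductivity.BirComplexStableXYNegative
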